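import Summits.AnomalousDissipation.AnomalousDissipation.Theorems.SolenoidalFractalHomogenisationRealisedQuasiStaticCellLawOutOfPlaneBlock
import Summits.AnomalousDissipation.AnomalousDissipation.Theorems.SolenoidalFractalHomogenisationPermissibleFractalCarrierBookkeeping
import Summits.AnomalousDissipation.AnomalousDissipation.Theorems.SolenoidalFractalHomogenisationCubatureMoments
import Literature.Analysis.FunctionSpaces.TorusHeatSmoothing
import HarnessLib

/-!
# K2R `RealisedQuasiStaticCellLaw`, line `floquet-bloch`, stub `stub_lowSectorDecay` (S1D): the slot constants of the
# quasi-statically replayed cell word in closed form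

Summits-side helper file (everything proved; no definitions, no named facts; `--supports stmt-AnomalousDissipation-20446`).
At the crux's word `W′ = (W.stretch M).stretch (1/ν)` and cell viscosity `κ = ν/n²`: slot `j` keeps `m_j, e_j, φ_j`, has duration
`τ′_j = Mτ_j/ν`, the period is `P′ = MP/ν`, the cell frequency `K_j = n m_j` has `|K_j|² = n²|m_j|²`, the diffusive rate of the
ladder is `Λ_j = κ·4π²|K_j|² = 4π²|m_j|²ν`, the layer amplitude has modulus `1/(4π|m_j|)`, the peak slot coupling is
`g₁,j = θ_j/(8π²|m_j|²‖m_j‖ n ν)` (`θ_j = Σ ê_j,i ℓ_i`) and the slot's diffusive time is `T_j = Λ_jτ′_j = 4π²|m_j|²Mτ_j`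
(independent of `ν`) — `cellSlot_formulas`. These identities feed every road of `stub_lowSectorDecay`.
-/

set_option linter.dupNamespace false

noncomputable section

namespace Summit.AnomalousDissipation.AnomalousDissipation.Theorems.SolenoidalFractalHomogenisation.RealisedQuasiStaticCellLaw

open Complex
open Literature.Analysis Literature.Analysis.FunctionSpaces Literature.Analysis.FunctionSpaces.Torus
open Literature.Analysis.FluidPDE Literature.Analysis.FluidPDE.LatticeShear
open Summit.AnomalousDissipation.AnomalousDissipation.Theorems.SolenoidalFractalHomogenisation.PermissibleCarrier

/-- `|n m|² = n²|m|²`. -/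
theorem freqNormSq_cellFreq (m : Fin 3 → ℤ) (n : ℕ) :
    freqNormSq (fun i => m i * (n : ℤ)) = (n : ℝ) ^ 2 * freqNormSq m := by
  unfold freqNormSq
  rw [Finset.mul_sum]
  refine Finset.sum_congr rfl fun i _ => ?_
  push_cast
  ring

/-- **Slot constants of the replayed cell word.** -/
theorem cellSlot_formulas {k₀ : ℕ} (W : LatticeWord k₀) {M ν : ℝ} (hM : 0 < M) (hν : 0 < ν) {n : ℕ} (hn : 0 < n)
    (j : Fin k₀) (ℓ : Fin 3 → ℤ) :
    (((W.stretch M hM).stretch (1 / ν) (one_div_pos.mpr hν)).phase j).m = (W.phase j).m ∧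
    (((W.stretch M hM).stretch (1 / ν) (one_div_pos.mpr hν)).phase j).e = (W.phase j).e ∧
    (((W.stretch M hM).stretch (1 / ν) (one_div_pos.mpr hν)).phase j).φ = (W.phase j).φ ∧
    (((W.stretch M hM).stretch (1 / ν) (one_div_pos.mpr hν)).phase j).τ = M * (W.phase j).τ / ν ∧
    ((W.stretch M hM).stretch (1 / ν) (one_div_pos.mpr hν)).ramp = W.ramp ∧
    ((W.stretch M hM).stretch (1 / ν) (one_div_pos.mpr hν)).period = M * W.period / ν ∧
    ν / (n : ℝ) ^ 2 * (4 * Real.pi ^ 2 * freqNormSq (fun i => (W.phase j).m i * (n : ℤ))) =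
      4 * Real.pi ^ 2 * freqNormSq (W.phase j).m * ν ∧
    ‖Complex.exp ((W.phase j).φ * Complex.I) *
        (1 / (2 * ((2 * Real.pi * ‖latticeVec (W.phase j).m‖ : ℝ) : ℂ) * Complex.I))‖ =
      1 / (4 * Real.pi * ‖latticeVec (W.phase j).m‖) ∧
    2 * Real.pi * (∑ i, (W.phase j).e i * (ℓ i : ℝ)) *
        ‖Complex.exp ((W.phase j).φ * Complex.I) *
          (1 / (2 * ((2 * Real.pi * ‖latticeVec (W.phase j).m‖ : ℝ) : ℂ) * Complex.I))‖ * (1 / (n : ℝ)) /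
        (ν / (n : ℝ) ^ 2 * (4 * Real.pi ^ 2 * freqNormSq (fun i => (W.phase j).m i * (n : ℤ)))) =
      (∑ i, (W.phase j).e i * (ℓ i : ℝ)) / (8 * Real.pi ^ 2 * freqNormSq (W.phase j).m * ‖latticeVec (W.phase j).m‖ * n * ν) ∧
    ν / (n : ℝ) ^ 2 * (4 * Real.pi ^ 2 * freqNormSq (fun i => (W.phase j).m i * (n : ℤ))) * (M * (W.phase j).τ / ν) =
      4 * Real.pi ^ 2 * freqNormSq (W.phase j).m * M * (W.phase j).τ := by
  obtain ⟨hm1, he1, hφ1, hτ1, hρ1⟩ := LatticeWord_stretch_phase (W.stretch M hM) (1 / ν) (one_div_pos.mpr hν) j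
  obtain ⟨hm0, he0, hφ0, hτ0, hρ0⟩ := LatticeWord_stretch_phase W M hM j
  have hn' : (0 : ℝ) < n := by exact_mod_cast hn
  have hmpos : 0 < ‖latticeVec (W.phase j).m‖ := lt_of_lt_of_le one_pos (one_le_norm_latticeVec (W.phase j).m_ne)
  have hfpos : 0 < freqNormSq (W.phase j).m := by rw [← norm_latticeVec_sq]; positivity
  have hK := freqNormSq_cellFreq (W.phase j).m n
  have hA := norm_layerAmp (W.phase j)
  refine ⟨by rw [hm1, hm0], by rw [he1, he0], by rw [hφ1, hφ0], by rw [hτ1, hτ0]; ring, by rw [hρ1, hρ0],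
    by rw [period_stretch, period_stretch]; ring, ?_, ?_, ?_, ?_⟩
  · rw [hK]; field_simp
  · rw [hA]; ring
  · rw [hA, hK]
    field_simp
    ring
  · rw [hK]; field_simp

end Summit.AnomalousDissipation.AnomalousDissipation.Theorems.SolenoidalFractalHomogenisation.RealisedQuasiStaticCellLaw

end
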